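import Summits.QuantumFields.YangMills.Theorems.FluctuationComparisonRegPrIntLS2BetaChartReadDescentOnto
import Literature.MathematicalPhysics.QuantumFieldTheory.Balaban1983to89.T3DescentFibreTower
import HarnessLib

/-!
# S2β · (SUBM-m) (s1)+(s2) AT THE ORGAN: THE CHART-READ DESCENT `A ↦ Λ(D_{J,K}(Θ^B(A)·U₀)(B)·D_{J,K}(U₀)(B)⁻¹)` IS `C^∞` AT `0` WITH ONTO DERIVATIVE FOR EVERY GOOD
# HISTORY `U₀` (the T³ edition of ✓`…S2BetaChartReadDescentOnto`: `descendTo F ℰp J K = fieldShift ∘ Ū^{K−J}`, the loop guard at every level from `histGood`)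

Cell `ym3-torus` (YM ladder rung R3 = continuum `SU(2)` Yang–Mills on the three-torus at fixed lattice data — a RUNG: NOT d = 4, NOT infinite volume, NOT a mass gap,
NOT Clay).  Width seat `ym3-torus-px13` (gen 25); crux `stmt-QuantumFields-20520` (`…Theses.UnitScaleTilt.FluctuationComparisonRegPrIntL`), LINE g18-1 S2β, organ GAP♯∘
⟸ (D♮) ∧ (F♮) ⟸ «CRIT♮» ⟸ «MULT♭» = CRIT-m♮ ∧ MULT♮ ∧ AVG₂♭; CRIT-m♮ ⟸ (SUBM-m) = (s1) ∧ (s2) ∧ (s3) (px5 g22 instance door ✓`…S2BetaCritMOfSubmersion`, (s3) + assembly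
px5).  THIS FILE answers px5 g22's binder request (bus 12:52:47Z): for `U₀ ∈ histGood F ℰp θ K J`, with `descendTo` (hence `fieldShift`) IN THE STATEMENT, (i) `ContDiffAt ℝ ⊤ Mc 0`
and (ii) `Function.Surjective (fderiv ℝ Mc 0)` for the T³ chart-read descent `Mc` in pub-ymgap N09's log-chart conventions — `--kind proof --supports stmt-QuantumFields-20520
--as helper`, count-neutral, DEFINITION-FREE (0 `def`, 0 `instance`, 0 `notation`, 0 `sorry`).

OBJECTS (CONSUMED BY NAME).  lit `T3TiltDescent.descendTo F ℰ n K h = fieldShift _ ∘ Averaging.iter (blockAvg ℰ) (K − n)` ([Balaban1987RG1] (0.11)), lit `T3LevelShift.fieldShift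
h V = V ∘ bondShift h` (`bondShift h` an `Equiv` of bonds), lit `T3UnitScaleTilt.histGood F ℰ θ K n` ([Balaban1985UV3] (7): `PlaqSmall (θ (K − j)) (Ū^j U)` for `j + n ≤ K`),
lit `T3UnitLawDensityEML.ℰp = expMeanLogSU (n := Fin 2)`, lit `LatticeWordStokes.dist1_loopHol_le`, `Θ`∕`Λ` = `expChart`∕`logChart` of `isChartRep_specialUnitaryGroup (n := Fin 2)`,
and ✓`…S2BetaChartReadDescentOnto` (generic k-step chart-read onto).  The T³ map is written OUT in every statement:
`Mc(A)(B) = Λ(descendTo F ℰp J K hJK (Θ^B(A)·U₀)(B) · descendTo F ℰp J K hJK U₀ (B)⁻¹)`, `A : PBond (F.P K) 0 → 𝔰𝔲(2)`, `B : PBond (F.P J) 0`.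

WHAT IS PROVED (sorry-free).
* §1 `loopGuard_of_histGood` — a good history's iterated averages `Ū^j(U₀)`, `j < K − J`, satisfy the loop `α`-guard as soon as `(5L)²∕4·θ_i ≤ α` at every height
  `J < i ≤ K` (`dist1_loopHol_le`, `d = 3`); `chartRead_descendTo_eq_comp` — `Mc = L_σ ∘ Ψ_{K−J}` with `L_σ Φ := Φ ∘ bondShift _` the CONTINUOUS LINEAR level
  identification (`rfl`); `surjective_reindex` — `L_σ` is onto (`bondShift` is a bijection).
* §2 ★★★`contDiffAt_chartRead_descendTo` — (i): `ContDiffAt ℝ ⊤ Mc 0` for `U₀ ∈ histGood F ℰp θ K J`, `0 ≤ θ`, `θ_i < δ_{SU(2)}·4∕(5L)²` on `(J, K]` (guard only);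
  ★★★`surjective_fderiv_chartRead_descendTo` — (ii): `Function.Surjective (fderiv ℝ Mc 0)` under the displayed numerics `(5L)²∕4·θ_i ≤ α` (`J < i ≤ K`), `α ≤ 1∕24`,
  `α < δ_{SU(2)}`, `157·α < L⁻²` (N09's, not optimised; vs `θBal`: a one-line check for `J ≥ j₀`, displayed — same status as UV3-NODE §77.9 (a));
  ★★`hasStrictFDerivAt_chartRead_descendTo` — (s1) ∧ (s2) in one line; `chartRead_descendTo_apply_zero` (`Mc 0 = 0`).

HONEST.  Bookkeeping (`fieldShift` is a linear bijection on chart coordinates) over ✓`…S2BetaChartReadDescentOnto` and pub-ymgap N07∕N09; NO estimate of Bałaban's; `DM` not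
computed (RINV-cov ∕ MULT♮ ∕ AVG₂♭ untouched); the bridge to the door's quaternionic source chart `expPoint` is FILE C; (s3)∕assembly (px5), CRIT-m♮, «CRIT♮», (D♮)∕(F♮), GAP♯∘
(registry UNTOUCHED), the five REGISTERED stubs, S2β, crux 20520, 19936, 19200 and `YM3TorusSU2` are NOT proved; no summit statement is proved by a helper; rung R3 = SU(2) YM₃
on T³ at fixed lattice data — NOT d = 4, NOT infinite volume, NOT a mass gap, NOT Clay; the Yang–Mills mass gap is NOT proved.  Axioms standard.

References: T. Bałaban, CMP **109** (1987) 249–301 [Balaban1987RG1] ((0.4), (0.8), (0.11) p.253); CMP **102** (1985) 255–275 [Balaban1985UV3] ((7) p.257: the small-field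
history); CMP **102** (1985) 277–309 [Balaban1985Variational] ((3) p.278, (44) p.285: the constraint `Ū^k = V` and its linearisation).
-/

set_option autoImplicit false

noncomputable section

open scoped Matrix.Norms.L2Operator Topology
open Filter Set Function

namespace Summit.QuantumFields.YangMills.Theorems.FluctuationComparisonRegPrIntLS2BetaChartReadDescentOntoT3

open Literature.MathematicalPhysics.QuantumFieldTheory.Balaban1983to89
open Literature.MathematicalPhysics.QuantumFieldTheory.Balaban1983to89.HaarExponentialChart
open Literature.MathematicalPhysics.QuantumFieldTheory.Balaban1983to89.HaarExponentialChart.IsChartRep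
open Literature.MathematicalPhysics.QuantumFieldTheory.Balaban1983to89.BlockAveraging (Small Idx avgFun loopHol blockAvg blockAvg_avg)
open Literature.MathematicalPhysics.QuantumFieldTheory.Balaban1983to89.ExpMeanLog (expMeanLogSU deltaSU)
open Literature.MathematicalPhysics.QuantumFieldTheory.Balaban1983to89.Node00
open Literature.MathematicalPhysics.QuantumFieldTheory.Balaban1983to89.T3ContinuumYM3Torus
open Literature.MathematicalPhysics.QuantumFieldTheory.Balaban1983to89.T3UnitLawDensityEML (ℰp)
open Literature.MathematicalPhysics.QuantumFieldTheory.Balaban1983to89.T3UnitScaleTilt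
open Literature.MathematicalPhysics.QuantumFieldTheory.Balaban1983to89.T3TiltDescent
open Literature.MathematicalPhysics.QuantumFieldTheory.Balaban1983to89.T3LevelShift (fieldShift bondShift)
open Summit.QuantumFields.YangMills.Theorems.FluctuationComparisonRegPrIntLS2BetaChartReadDescentOnto

variable {F : T3Family}

/-! ## §1 The loop guard of a good history; the level identification as a continuous linear surjection -/

section Guard

/-- A GOOD HISTORY IS IN THE LOOP GUARD AT EVERY AVERAGED LEVEL BELOW `K − J`: for `U₀ ∈ histGood F ℰp θ K J` (every `Ū^j(U₀)`, `j + J ≤ K`, has plaquettes within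
`θ (K − j)` of `1`), `0 ≤ θ`, and `(5L)²∕4·θ_i ≤ α` for `J < i ≤ K`: `dist1 (loopHol (Ū^j U₀) c idx) ≤ α` for all `j < K − J` (the (0.4) loop words have length `≤ (d+2)L = 5L`).
[cite: Balaban1985UV3, (7) p.257; Balaban1987RG1, (0.4) p.253] -/
theorem loopGuard_of_histGood {J K : ℕ} {θ : ℕ → ℝ} (hθ0 : ∀ i, 0 ≤ θ i) {α : ℝ}
    (hθα : ∀ i, J < i → i ≤ K → (((5 * F.L : ℕ) : ℝ) ^ 2 / 4) * θ i ≤ α)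
    {U₀ : GaugeField (F.P K) 0 (SU 2)} (hUg : U₀ ∈ histGood F ℰp θ K J) :
    ∀ j, j < K - J → ∀ (c : PBond (F.P K) (j + 1)) (idx : Idx (F.P K)),
      dist1 (loopHol (Averaging.iter (fun i => blockAvg (P := F.P K) (j := i) (expMeanLogSU (n := Fin 2))) j U₀) c idx) ≤ α := by
  intro j hj c idx
  have hsmall : PlaqSmall (θ (K - j)) (Averaging.iter (fun i => blockAvg (P := F.P K) (j := i) (expMeanLogSU (n := Fin 2))) j U₀) :=
    hUg j (by omega)
  have h := LatticeWordStokes.dist1_loopHol_le (hθ0 (K - j)) hsmall c idx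
  have hd : ((((F.P K).d + 2) * (F.P K).L : ℕ) : ℝ) = ((5 * F.L : ℕ) : ℝ) := by
    show ((((3 + 2) * F.L : ℕ)) : ℝ) = ((5 * F.L : ℕ) : ℝ)
    norm_num
  rw [hd] at h
  exact h.trans (hθα (K - j) (by omega) (by omega))

/-- The (0.4) guard below `K − J` for a good history, from `θ_i·(5L)²∕4 < δ_{SU(2)}` at every height `J < i ≤ K` (for (i): smoothness needs only the guard).
[cite: Balaban1985UV3, (7) p.257; Balaban1987RG1, (0.4) p.253] -/
theorem smallBelow_of_histGood {J K : ℕ} {θ : ℕ → ℝ} (hθ0 : ∀ i, 0 ≤ θ i)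
    (hθδ : ∀ i, J < i → i ≤ K → (((5 * F.L : ℕ) : ℝ) ^ 2 / 4) * θ i < deltaSU (Fin 2))
    {U₀ : GaugeField (F.P K) 0 (SU 2)} (hUg : U₀ ∈ histGood F ℰp θ K J) :
    SmallBelow (fun i => blockAvg (P := F.P K) (j := i) (expMeanLogSU (n := Fin 2))) (K - J) U₀ := by
  intro j hj c idx
  have hsmall : PlaqSmall (θ (K - j)) (Averaging.iter (fun i => blockAvg (P := F.P K) (j := i) (expMeanLogSU (n := Fin 2))) j U₀) :=
    hUg j (by omega)
  have h := LatticeWordStokes.dist1_loopHol_le (hθ0 (K - j)) hsmall c idx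
  have hd : ((((F.P K).d + 2) * (F.P K).L : ℕ) : ℝ) = ((5 * F.L : ℕ) : ℝ) := by
    show ((((3 + 2) * F.L : ℕ)) : ℝ) = ((5 * F.L : ℕ) : ℝ)
    norm_num
  rw [hd] at h
  exact lt_of_le_of_lt h (hθδ (K - j) (by omega) (by omega))

/-- **THE CHART-READ DESCENT IS THE LEVEL IDENTIFICATION AFTER THE k-STEP CHART-READ AVERAGE**: `Mc = L_σ ∘ Ψ_{K−J}` with `L_σ Φ = Φ ∘ bondShift _` (`rfl`:
`descendTo = fieldShift ∘ Ū^{K−J}`, `fieldShift h V = V ∘ bondShift h`). [cite: Balaban1987RG1, (0.11) p.253 (bookkeeping)] -/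
theorem chartRead_descendTo_eq_comp {J K : ℕ} (hJK : J ≤ K) (U₀ : GaugeField (F.P K) 0 (SU 2)) :
    (fun (A : PBond (F.P K) 0 → (specialUnitaryLogChart (Fin 2)).lie) (B : PBond (F.P J) 0) =>
        (isChartRep_specialUnitaryGroup (n := Fin 2)).logChart
          (descendTo F ℰp J K hJK (fun b => (isChartRep_specialUnitaryGroup (n := Fin 2)).expChart (A b) * U₀ b) B *
            (descendTo F ℰp J K hJK U₀ B)⁻¹)) =
      (ContinuousLinearMap.pi fun B : PBond (F.P J) 0 =>
          ContinuousLinearMap.proj (R := ℝ) (φ := fun _ : PBond (F.P K) (K - J) => (specialUnitaryLogChart (Fin 2)).lie)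
            (bondShift (F.sitesPerDir_eq (m := F.m) (K := J) (j := 0) (m' := F.m) (K' := K) (j' := K - J) (by omega)) B)) ∘
        (fun (A : PBond (F.P K) 0 → (specialUnitaryLogChart (Fin 2)).lie) (c : PBond (F.P K) (K - J)) =>
          (isChartRep_specialUnitaryGroup (n := Fin 2)).logChart
            (Averaging.iter (fun i => blockAvg (P := F.P K) (j := i) (expMeanLogSU (n := Fin 2))) (K - J)
                (fun b => (isChartRep_specialUnitaryGroup (n := Fin 2)).expChart (A b) * U₀ b) c *
              (Averaging.iter (fun i => blockAvg (P := F.P K) (j := i) (expMeanLogSU (n := Fin 2))) (K - J) U₀ c)⁻¹)) := rfl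

/-- The level identification `L_σ : Φ ↦ Φ ∘ bondShift _` is ONTO (`bondShift` is a bijection of bonds). [cite: Balaban1987RG1, (0.1) p.251 (bookkeeping)] -/
theorem surjective_reindex {J K : ℕ} (hJK : J ≤ K) :
    Function.Surjective (ContinuousLinearMap.pi fun B : PBond (F.P J) 0 =>
      ContinuousLinearMap.proj (R := ℝ) (φ := fun _ : PBond (F.P K) (K - J) => (specialUnitaryLogChart (Fin 2)).lie)
        (bondShift (F.sitesPerDir_eq (m := F.m) (K := J) (j := 0) (m' := F.m) (K' := K) (j' := K - J) (by omega)) B)) := by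
  intro Z
  refine ⟨fun c => Z ((bondShift (F.sitesPerDir_eq (m := F.m) (K := J) (j := 0) (m' := F.m) (K' := K) (j' := K - J) (by omega))).symm c), ?_⟩
  funext B
  simp only [ContinuousLinearMap.pi_apply, ContinuousLinearMap.proj_apply, Equiv.symm_apply_apply]

end Guard

/-! ## §2 (i) smoothness and (ii) onto derivative of the T³ chart-read descent at a good history -/

section Organ

/-- `Mc 0 = 0`. [cite: Balaban1987RG1, (0.11) p.253 (bookkeeping)] -/
theorem chartRead_descendTo_apply_zero {J K : ℕ} (hJK : J ≤ K) (U₀ : GaugeField (F.P K) 0 (SU 2)) :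
    (fun (B : PBond (F.P J) 0) =>
        (isChartRep_specialUnitaryGroup (n := Fin 2)).logChart
          (descendTo F ℰp J K hJK (fun b => (isChartRep_specialUnitaryGroup (n := Fin 2)).expChart
              ((0 : PBond (F.P K) 0 → (specialUnitaryLogChart (Fin 2)).lie) b) * U₀ b) B *
            (descendTo F ℰp J K hJK U₀ B)⁻¹)) = 0 := by
  have h := congrFun (chartRead_descendTo_eq_comp (F := F) hJK U₀) 0
  simp only [Function.comp_apply] at h
  rw [h]
  have h0 := chartRead_iter_apply_zero (P := F.P K) (N := 2) U₀ (K - J)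
  rw [h0, map_zero]

/-- ★★★ **(i) THE CHART-READ DESCENT IS `C^∞` AT `0` AT EVERY GOOD HISTORY** (guard only: `0 ≤ θ` and `(5L)²∕4·θ_i < δ_{SU(2)}` for `J < i ≤ K`).
[cite: Balaban1987RG1, (0.4) p.253 («analytic function»), (0.11) p.253; Balaban1985UV3, (7) p.257] -/
theorem contDiffAt_chartRead_descendTo {J K : ℕ} (hJK : J ≤ K) {θ : ℕ → ℝ} (hθ0 : ∀ i, 0 ≤ θ i)
    (hθδ : ∀ i, J < i → i ≤ K → (((5 * F.L : ℕ) : ℝ) ^ 2 / 4) * θ i < deltaSU (Fin 2))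
    {U₀ : GaugeField (F.P K) 0 (SU 2)} (hUg : U₀ ∈ histGood F ℰp θ K J) :
    ContDiffAt ℝ ⊤ (fun (A : PBond (F.P K) 0 → (specialUnitaryLogChart (Fin 2)).lie) (B : PBond (F.P J) 0) =>
        (isChartRep_specialUnitaryGroup (n := Fin 2)).logChart
          (descendTo F ℰp J K hJK (fun b => (isChartRep_specialUnitaryGroup (n := Fin 2)).expChart (A b) * U₀ b) B *
            (descendTo F ℰp J K hJK U₀ B)⁻¹)) 0 := by
  rw [chartRead_descendTo_eq_comp (F := F) hJK U₀]
  have hΨ := contDiffAt_chartRead_iter (P := F.P K) (N := 2) U₀ (K - J) (smallBelow_of_histGood (F := F) hθ0 hθδ hUg)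
  exact (ContinuousLinearMap.contDiff _).contDiffAt.comp 0 hΨ

/-- ★★★ **(ii) THE CHART-READ DESCENT HAS ONTO DERIVATIVE AT `0` AT EVERY GOOD HISTORY** — the `hsurj` input of ✓`…S2BetaCritMOfSubmersion` in the log-chart conventions:
`Function.Surjective (fderiv ℝ Mc 0)` for `U₀ ∈ histGood F ℰp θ K J`, under the displayed numerics `0 ≤ θ`, `(5L)²∕4·θ_i ≤ α` (`J < i ≤ K`), `α ≤ 1∕24`, `α < δ_{SU(2)}`,
`157·α < L⁻²` (chain: ✓`surjective_fderiv_chartRead_iter` at `k = K − J ≤ m + K`, then the onto linear level identification).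
[cite: Balaban1987RG1, (0.4), (0.8), (0.11) p.253; Balaban1985Averaging, Prop. 3 (122)-(124) p.36; Balaban1985UV3, (7) p.257] -/
theorem surjective_fderiv_chartRead_descendTo {J K : ℕ} (hJK : J ≤ K) {θ : ℕ → ℝ} (hθ0 : ∀ i, 0 ≤ θ i) {α : ℝ}
    (hθα : ∀ i, J < i → i ≤ K → (((5 * F.L : ℕ) : ℝ) ^ 2 / 4) * θ i ≤ α)
    (hα24 : α ≤ 1 / 24) (hαδ : α < deltaSU (Fin 2)) (hαL : 157 * α < ((F.L : ℝ) ^ 2)⁻¹)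
    {U₀ : GaugeField (F.P K) 0 (SU 2)} (hUg : U₀ ∈ histGood F ℰp θ K J) :
    Function.Surjective (fderiv ℝ (fun (A : PBond (F.P K) 0 → (specialUnitaryLogChart (Fin 2)).lie) (B : PBond (F.P J) 0) =>
        (isChartRep_specialUnitaryGroup (n := Fin 2)).logChart
          (descendTo F ℰp J K hJK (fun b => (isChartRep_specialUnitaryGroup (n := Fin 2)).expChart (A b) * U₀ b) B *
            (descendTo F ℰp J K hJK U₀ B)⁻¹)) 0) := by
  have hguard := loopGuard_of_histGood (F := F) hθ0 hθα hUg
  have hk : K - J ≤ (F.P K).m + (F.P K).K := by show K - J ≤ F.m + K; omega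
  have hαL' : 157 * α < (((F.P K).L : ℝ) ^ ((F.P K).d - 1))⁻¹ := by show 157 * α < ((F.L : ℝ) ^ (3 - 1))⁻¹; exact hαL
  obtain ⟨hC, hR⟩ := contDiffAt_and_range_fderiv_chartRead_iter (P := F.P K) (N := 2) U₀ hα24 hαδ hαL' (K - J) hk hguard
  have hS : Function.Surjective (fderiv ℝ (fun (A : PBond (F.P K) 0 → (specialUnitaryLogChart (Fin 2)).lie) (c : PBond (F.P K) (K - J)) =>
      (isChartRep_specialUnitaryGroup (n := Fin 2)).logChart
        (Averaging.iter (fun i => blockAvg (P := F.P K) (j := i) (expMeanLogSU (n := Fin 2))) (K - J)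
            (fun b => (isChartRep_specialUnitaryGroup (n := Fin 2)).expChart (A b) * U₀ b) c *
          (Averaging.iter (fun i => blockAvg (P := F.P K) (j := i) (expMeanLogSU (n := Fin 2))) (K - J) U₀ c)⁻¹)) 0) := by
    rw [LinearMap.range_eq_top] at hR; exact hR
  set Ψ := fun (A : PBond (F.P K) 0 → (specialUnitaryLogChart (Fin 2)).lie) (c : PBond (F.P K) (K - J)) =>
      (isChartRep_specialUnitaryGroup (n := Fin 2)).logChart
        (Averaging.iter (fun i => blockAvg (P := F.P K) (j := i) (expMeanLogSU (n := Fin 2))) (K - J)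
            (fun b => (isChartRep_specialUnitaryGroup (n := Fin 2)).expChart (A b) * U₀ b) c *
          (Averaging.iter (fun i => blockAvg (P := F.P K) (j := i) (expMeanLogSU (n := Fin 2))) (K - J) U₀ c)⁻¹) with hΨ
  set Lσ := (ContinuousLinearMap.pi fun B : PBond (F.P J) 0 =>
      ContinuousLinearMap.proj (R := ℝ) (φ := fun _ : PBond (F.P K) (K - J) => (specialUnitaryLogChart (Fin 2)).lie)
        (bondShift (F.sitesPerDir_eq (m := F.m) (K := J) (j := 0) (m' := F.m) (K' := K) (j' := K - J) (by omega)) B)) with hLσ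
  rw [chartRead_descendTo_eq_comp (F := F) hJK U₀]
  have hΨD : HasFDerivAt Ψ (fderiv ℝ Ψ 0) 0 := (hC.differentiableAt (by simp)).hasFDerivAt
  have hcomp : HasFDerivAt (⇑Lσ ∘ Ψ) (Lσ.comp (fderiv ℝ Ψ 0)) 0 :=
    HasFDerivAt.comp (𝕜 := ℝ) (f := Ψ) (f' := fderiv ℝ Ψ 0) (g := ⇑Lσ) (g' := Lσ) (0 : PBond (F.P K) 0 → (specialUnitaryLogChart (Fin 2)).lie)
      Lσ.hasFDerivAt hΨD
  rw [hcomp.fderiv, ContinuousLinearMap.coe_comp]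
  exact (surjective_reindex (F := F) hJK).comp hS

/-- ★★ **(s1) ∧ (s2) AT THE ORGAN, IN ONE LINE**: `HasStrictFDerivAt Mc (fderiv ℝ Mc 0) 0 ∧ Function.Surjective (fderiv ℝ Mc 0)` for every good history `U₀`
(the `hMc`∕`hsurj` inputs of ✓`…S2BetaCritMOfSubmersion.exists_multiplier_of_subm`, log-chart conventions; the quaternionic source chart `expPoint` is reached through FILE C).
[cite: Balaban1987RG1, (0.4), (0.8), (0.11) p.253; Balaban1985Variational, (3) p.278, (44) p.285; Balaban1985UV3, (7) p.257] -/
theorem hasStrictFDerivAt_chartRead_descendTo {J K : ℕ} (hJK : J ≤ K) {θ : ℕ → ℝ} (hθ0 : ∀ i, 0 ≤ θ i) {α : ℝ}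
    (hθα : ∀ i, J < i → i ≤ K → (((5 * F.L : ℕ) : ℝ) ^ 2 / 4) * θ i ≤ α)
    (hα24 : α ≤ 1 / 24) (hαδ : α < deltaSU (Fin 2)) (hαL : 157 * α < ((F.L : ℝ) ^ 2)⁻¹)
    {U₀ : GaugeField (F.P K) 0 (SU 2)} (hUg : U₀ ∈ histGood F ℰp θ K J) :
    HasStrictFDerivAt (fun (A : PBond (F.P K) 0 → (specialUnitaryLogChart (Fin 2)).lie) (B : PBond (F.P J) 0) =>
        (isChartRep_specialUnitaryGroup (n := Fin 2)).logChart
          (descendTo F ℰp J K hJK (fun b => (isChartRep_specialUnitaryGroup (n := Fin 2)).expChart (A b) * U₀ b) B *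
            (descendTo F ℰp J K hJK U₀ B)⁻¹))
      (fderiv ℝ (fun (A : PBond (F.P K) 0 → (specialUnitaryLogChart (Fin 2)).lie) (B : PBond (F.P J) 0) =>
        (isChartRep_specialUnitaryGroup (n := Fin 2)).logChart
          (descendTo F ℰp J K hJK (fun b => (isChartRep_specialUnitaryGroup (n := Fin 2)).expChart (A b) * U₀ b) B *
            (descendTo F ℰp J K hJK U₀ B)⁻¹)) 0) 0 ∧
    Function.Surjective (fderiv ℝ (fun (A : PBond (F.P K) 0 → (specialUnitaryLogChart (Fin 2)).lie) (B : PBond (F.P J) 0) =>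
        (isChartRep_specialUnitaryGroup (n := Fin 2)).logChart
          (descendTo F ℰp J K hJK (fun b => (isChartRep_specialUnitaryGroup (n := Fin 2)).expChart (A b) * U₀ b) B *
            (descendTo F ℰp J K hJK U₀ B)⁻¹)) 0) := by
  have hθδ : ∀ i, J < i → i ≤ K → (((5 * F.L : ℕ) : ℝ) ^ 2 / 4) * θ i < deltaSU (Fin 2) :=
    fun i hi hiK => lt_of_le_of_lt (hθα i hi hiK) hαδ
  exact ⟨(contDiffAt_chartRead_descendTo (F := F) hJK hθ0 hθδ hUg).hasStrictFDerivAt (by simp),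
    surjective_fderiv_chartRead_descendTo (F := F) hJK hθ0 hθα hα24 hαδ hαL hUg⟩

end Organ

end Summit.QuantumFields.YangMills.Theorems.FluctuationComparisonRegPrIntLS2BetaChartReadDescentOntoT3

end
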